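/-
Copyright (c) 2026. All rights reserved.
Released under Apache 2.0 license as described in the file LICENSE.
Authors: abc-iut cell, seat abc-iut-f-141 (F fact-proving wave, tranche 141: FACT-LIST rows F-0593
`OfTypeLTorsPm`, F-0594 `OfTypeLTorsTheta`, F-0595 `OfTypeLTorsThetaPm`; with F-0592 `OfTypeLTors`).
-/
import Literature.AnabelianGeometry.EtaleTheta.ThetaCoversOfType
import Literature.AnabelianGeometry.EtaleTheta.Discharge.Sec2DoubleCoverProofs
import Literature.AnabelianGeometry.EtaleTheta.Discharge.Sec2AutKNormalizersC
import Literature.AnabelianGeometry.EtaleTheta.ThetaCoversTempered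

/-!
# [EtTh] Definitions 2.1 / 2.3 — the four "of type" predicates AT THE NAMED INSTANCE the cone
# consumes: the tower `Π_X̲̲ ⊆ Π_X̲ ⊆ Π_X`, `Π_C̲̲ ⊆ Π_C̲` of the Def 2.5 interface `TemperedCoverData`
# (proof-only; instance forms of FACT-LIST rows F-0592 – F-0595)

Mochizuki, *The Étale Theta Function and its Frobenioid-theoretic Manifestations* [EtTh], Publ. RIMS
45 (2009), §2, Definition 2.1 (PRIMS p.36): "We shall refer to a smooth log orbicurve over `K` that
arises, up to isomorphism, as `X̲^log` (respectively, `C̲^log`) … as being of type `(1, l-tors)`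
(respectively, `(1, l-tors)±`)"; Definition 2.3 (p.38): "… as `X̲̲^log` (respectively, `C̲̲^log`) … of
type `(1, l-torsΘ)` (respectively, `(1, l-torsΘ)±`)"; and the cartesian diagrams `X̲ → X` over `C̲ → C`
(Def 2.1, p.36), `X̲̲ → X̲` over `C̲̲ → C̲` (Prop 2.2 (iii), p.37).  Bib key `MochizukiEtTh2009`.

PROOF-ONLY companion of abc-iut-L2-t2's statement files `ThetaCovers.lean` (p405102: the predicates
`CoverData.OfTypeLTors` / `OfTypeLTorsPm` / `OfTypeLTorsTheta` / `OfTypeLTorsThetaPm` = FACT-LIST rows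
F-0592 – F-0595, VOCABULARY of print) and `ThetaCoversTempered.lean` (the Def 2.5 interface
`TemperedCoverData`: a CHOSEN `Π_C̲̲ = T.PiCuu` of type `(1, l-torsΘ)±` — field `isTypeLTorsThetaPm` — and
the derived tower members `Π_X̲̲ = T.PiXuu := Π_C̲̲ ∩ Π_X`, `Π_X̲ = T.PiXu := Π_X̲̲·Δ̄_Θ`,
`Π_C̲ = T.PiCu := Π_C̲̲·Δ̄_Θ`, which is what EVERY downstream [EtTh] §2 consumer in the tree is fed:
Prop 2.4, Def 2.5, Rmk 2.6.1, Cor 2.9, …).  Plan R5 for these schema rows: the universal closures are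
REFUTED (abc-iut-w6-d032, `ThetaCoversOfTypeClosure.lean` p428681: `not_forall_ofTypeLTors{,Pm,Theta,
ThetaPm}`) and instance forms were PROVED there at a consistency toy (`heisenbergWitness`); THIS file
proves the instance forms AT THE NAMED INSTANCE of the cone, for EVERY `T : TemperedCoverData l`, with
no hypothesis:

* over any `X : CoverDataAx l` (§A) — **a subgroup of type `(1, l-torsΘ)±` determines its tower**: if
  `Π_C̲̲ = H₂'` is of type `(1, l-torsΘ)±` then `H₂'·Δ̄_Θ` IS a `Π_C̲` of type `(1, l-tors)±`
  (`isTypeLTorsPm_sup_barTheta`), `H₂' ∩ Π_X` IS a `Π_X̲̲` of type `(1, l-torsΘ)`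
  (`isTypeLTorsTheta_inf_PiX`), and `(H₂' ∩ Π_X)·Δ̄_Θ` IS a `Π_X̲` of type `(1, l-tors)`
  (`isTypeLTors_inf_PiX_sup_barTheta`) — assembled BY NAME from abc-iut-L2-t10's / -d3's identities
  `sup_zpowers_sup_barTheta_eq` (`⟨S·E, ι̲⟩·Δ̄_Θ = Π_C̲`), `sup_zpowers_inf_eq` (`⟨S·E, ι̲⟩ ∩ Π_X̲ = S·E`,
  Prop 2.2 (iii)), `sup_eigen_sup_barTheta_eq'` (`(S·E)·Δ̄_Θ = Π_X̲`); and the same "up to isomorphism"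
  (`OfType…` versions: conjugation by `c ∈ Π_C` commutes with `· ⊔ Δ̄_Θ` and `· ⊓ Π_X`, both normal);
* over any `T : TemperedCoverData l` (§B) — **the named instance**: `T.PiXu`, `T.PiCu`, `T.PiXuu`, `T.PiCuu`
  ARE of type `(1, l-tors)`, `(1, l-tors)±`, `(1, l-torsΘ)`, `(1, l-torsΘ)±` (`isTypeLTors_PiXu`,
  `isTypeLTorsPm_PiCu`, `isTypeLTorsTheta_PiXuu`, field `isTypeLTorsThetaPm`), hence the FQ instance-form
  closers `ofTypeLTors_holds` (F-0592), `ofTypeLTorsPm_holds` (F-0593), `ofTypeLTorsTheta_holds` (F-0594),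
  `ofTypeLTorsThetaPm_holds` (F-0595); and the cartesian square `Π_X̲ = Π_C̲ ∩ Π_X` (`PiXu_eq_PiCu_inf_PiX`;
  `Π_X̲̲ = Π_C̲̲ ∩ Π_X` is the definition of `PiXuu`).

HONEST FRAMING: the four predicates are DEFINITIONS of print, not printed claims; "instance form proved"
means exactly the theorems below (the interface's own tower members satisfy the interface's own
predicates), nothing about print beyond that; the universal closures stay false (R5: facts at NAMED
instances only).  Nothing here asserts that a `TemperedCoverData` exists; [EtTh] §2 is refereed pre-IUT
group theory over the typed interface; no side is taken on [IUTchIII] Cor. 3.12; typed ≠ proved except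
for the theorems of this file.  No definitions, no `sorry`.
-/

namespace Literature.AnabelianGeometry.EtaleTheta

namespace ThetaCovers

universe u

/-! ## §A. Over `CoverDataAx`: a subgroup of type `(1, l-torsΘ)±` determines its tower -/

namespace CoverDataAx

variable {l : ℕ} (X : CoverDataAx.{u} l)

/-- **`Π_C̲̲·Δ̄_Θ = Π_C̲` is of type `(1, l-tors)±`**: for `H₂' = ⟨S·E, ι̲⟩` of type `(1, l-torsΘ)±` built over
`Π_C̲ = H'`, `H₂'·Δ̄_Θ = H'` (abc-iut-L2-t10 `sup_zpowers_sup_barTheta_eq`), and `H'` is of type `(1, l-tors)±`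
by construction (Def 2.3 is built ON a `C̲` of Def 2.1). [cite: MochizukiEtTh2009, Def 2.3 p.38] -/
theorem isTypeLTorsPm_sup_barTheta {H2' : Subgroup X.PiC}
    (h : X.toCoverData.IsTypeLTorsThetaPm H2') : X.toCoverData.IsTypeLTorsPm (H2' ⊔ X.barTheta) := by
  obtain ⟨H', E, S, ι, hH', hι, -, hE, hS, rfl⟩ := h.out
  rw [X.sup_zpowers_sup_barTheta_eq hH' hι hE hS]
  exact hH'

/-- `Π_C̲̲ ⊆ Π_C̲`: `⟨S·E, ι̲⟩ ≤ H'`. [cite: MochizukiEtTh2009, Def 2.3 p.38] -/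
theorem le_of_data {H' E S : Subgroup X.PiC} {ι : X.PiC} (hH' : X.toCoverData.IsTypeLTorsPm H')
    (hι : X.toCoverData.IsInversion H' ι) (hE : X.toCoverData.IsMinusEigen (H' ⊓ X.PiX) H' ι E)
    (hS : X.toCoverData.IsSplitting S) : (S ⊔ E) ⊔ Subgroup.zpowers ι ≤ H' := by
  conv_rhs => rw [← X.sup_zpowers_sup_barTheta_eq hH' hι hE hS]
  exact le_sup_left

/-- **Cartesian square `X̲̲ → X̲` over `C̲̲ → C̲`, profinite form: `Π_C̲̲ ∩ Π_X = Π_X̲̲ = S·E`** (Prop 2.2 (iii):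
`⟨Π_X̲̲, ι̲⟩ ∩ Π_X̲ = Π_X̲̲`, abc-iut-L2-d3 `sup_zpowers_inf_eq`, and `Π_C̲̲ ≤ Π_C̲`).
[cite: MochizukiEtTh2009, Prop 2.2 (iii) p.37] -/
theorem sup_zpowers_inf_PiX_eq {H' E S : Subgroup X.PiC} {ι : X.PiC}
    (hH' : X.toCoverData.IsTypeLTorsPm H') (hι : X.toCoverData.IsInversion H' ι) (h2 : ι * ι ∈ X.barKer)
    (hE : X.toCoverData.IsMinusEigen (H' ⊓ X.PiX) H' ι E) (hS : X.toCoverData.IsSplitting S) :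
    ((S ⊔ E) ⊔ Subgroup.zpowers ι) ⊓ X.PiX = S ⊔ E :=
  calc ((S ⊔ E) ⊔ Subgroup.zpowers ι) ⊓ X.PiX
      = (((S ⊔ E) ⊔ Subgroup.zpowers ι) ⊓ H') ⊓ X.PiX := by
        rw [inf_eq_left.mpr (X.le_of_data hH' hι hE hS)]
    _ = ((S ⊔ E) ⊔ Subgroup.zpowers ι) ⊓ (H' ⊓ X.PiX) := inf_assoc _ _ _
    _ = S ⊔ E := X.sup_zpowers_inf_eq hH' rfl hι hE hS h2

/-- **`Π_C̲̲ ∩ Π_X = Π_X̲̲` is of type `(1, l-torsΘ)`**: for `H₂' = ⟨S·E, ι̲⟩` of type `(1, l-torsΘ)±`,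
`H₂' ∩ Π_X = S·E` (`sup_zpowers_inf_PiX_eq`), which is the `Π_X̲̲` of Def 2.3 for the same data.
[cite: MochizukiEtTh2009, Def 2.3 p.38] -/
theorem isTypeLTorsTheta_inf_PiX {H2' : Subgroup X.PiC} (h : X.toCoverData.IsTypeLTorsThetaPm H2') :
    X.toCoverData.IsTypeLTorsTheta (H2' ⊓ X.PiX) := by
  obtain ⟨H', E, S, ι, hH', hι, h2, hE, hS, rfl⟩ := h.out
  rw [X.sup_zpowers_inf_PiX_eq hH' hι h2 hE hS]
  exact ⟨⟨H', E, S, ι, hH', hι, hE, hS, rfl⟩⟩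

/-- **`Π_X̲̲·Δ̄_Θ = Π_X̲` is of type `(1, l-tors)`**: for `H₂' = ⟨S·E, ι̲⟩` of type `(1, l-torsΘ)±` over
`Π_C̲ = H'`, `(H₂' ∩ Π_X)·Δ̄_Θ = (S·E)·Δ̄_Θ = H' ∩ Π_X` (abc-iut-L2-t10 `sup_eigen_sup_barTheta_eq'`; Prop 2.2
(ii) "`Δ̄_X̲ = Δ̄_X̲̲·Δ̄_Θ`"), and `H' ∩ Π_X = Π_X̲` is of type `(1, l-tors)` (Def 2.1, field `inf_isTypeLTors`).
[cite: MochizukiEtTh2009, Def 2.1 p.36] -/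
theorem isTypeLTors_inf_PiX_sup_barTheta {H2' : Subgroup X.PiC}
    (h : X.toCoverData.IsTypeLTorsThetaPm H2') :
    X.toCoverData.IsTypeLTors ((H2' ⊓ X.PiX) ⊔ X.barTheta) := by
  obtain ⟨H', E, S, ι, hH', hι, h2, hE, hS, rfl⟩ := h.out
  rw [X.sup_zpowers_inf_PiX_eq hH' hι h2 hE hS, X.sup_eigen_sup_barTheta_eq' hH' hE hS]
  exact hH'.inf_isTypeLTors

/-- **Cartesian square `X̲ → X` over `C̲ → C`, profinite form: `Π_C̲ ∩ Π_X = Π_X̲`**, for the tower of a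
subgroup `H₂'` of type `(1, l-torsΘ)±`: `(H₂'·Δ̄_Θ) ∩ Π_X = (H₂' ∩ Π_X)·Δ̄_Θ` (both sides are `H' ∩ Π_X`).
[cite: MochizukiEtTh2009, Def 2.1 p.36] -/
theorem sup_barTheta_inf_PiX_eq {H2' : Subgroup X.PiC} (h : X.toCoverData.IsTypeLTorsThetaPm H2') :
    (H2' ⊔ X.barTheta) ⊓ X.PiX = (H2' ⊓ X.PiX) ⊔ X.barTheta := by
  obtain ⟨H', E, S, ι, hH', hι, h2, hE, hS, rfl⟩ := h.out
  rw [X.sup_zpowers_sup_barTheta_eq hH' hι hE hS, X.sup_zpowers_inf_PiX_eq hH' hι h2 hE hS,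
    X.sup_eigen_sup_barTheta_eq' hH' hE hS]

/-! ### "Up to isomorphism": the same three passages for the `OfType…` predicates -/

/-- Conjugation by `c ∈ Π_C` commutes with `· ⊔ Δ̄_Θ` (`Δ̄_Θ`-preimage is normal in `Π_C`).
(bookkeeping for "up to isomorphism", Def 2.1/2.3) [cite: MochizukiEtTh2009, Def 2.1 p.36] -/
theorem map_conj_sup_barTheta (H : Subgroup X.PiC) (c : X.PiC) :
    (H ⊔ X.barTheta).map (MulAut.conj c).toMonoidHom = H.map (MulAut.conj c).toMonoidHom ⊔ X.barTheta := by
  rw [Subgroup.map_sup, CoverData.map_conj_of_normal X.barTheta X.barTheta_normal c]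

/-- Conjugation by `c ∈ Π_C` commutes with `· ⊓ Π_X` (`Π_X` is normal in `Π_C`, conjugation is injective).
(bookkeeping for "up to isomorphism", Def 2.1/2.3) [cite: MochizukiEtTh2009, Def 2.1 p.36] -/
theorem map_conj_inf_PiX (H : Subgroup X.PiC) (c : X.PiC) :
    (H ⊓ X.PiX).map (MulAut.conj c).toMonoidHom = H.map (MulAut.conj c).toMonoidHom ⊓ X.PiX := by
  rw [Subgroup.map_inf_eq _ _ _ (MulAut.conj c).injective,
    CoverData.map_conj_of_normal X.PiX X.PiX_normal c]

/-- **Def 2.3 ⇒ Def 2.1, up to isomorphism**: if `H₂'` is of type `(1, l-torsΘ)±` (some `Π_C`-conjugate is a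
`Π_C̲̲` of the construction) then `H₂'·Δ̄_Θ` is of type `(1, l-tors)±` (the same conjugate, by
`isTypeLTorsPm_sup_barTheta`). [cite: MochizukiEtTh2009, Def 2.3 p.38] -/
theorem ofTypeLTorsPm_sup_barTheta {H2' : Subgroup X.PiC} (h : X.toCoverData.OfTypeLTorsThetaPm H2') :
    X.toCoverData.OfTypeLTorsPm (H2' ⊔ X.barTheta) := by
  obtain ⟨c, hc⟩ := h
  exact ⟨c, by rw [X.map_conj_sup_barTheta]; exact X.isTypeLTorsPm_sup_barTheta hc⟩

/-- **Def 2.3, up to isomorphism**: if `H₂'` is of type `(1, l-torsΘ)±` then `H₂' ∩ Π_X` is of type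
`(1, l-torsΘ)` (by `isTypeLTorsTheta_inf_PiX` on the conjugate). [cite: MochizukiEtTh2009, Def 2.3 p.38] -/
theorem ofTypeLTorsTheta_inf_PiX {H2' : Subgroup X.PiC} (h : X.toCoverData.OfTypeLTorsThetaPm H2') :
    X.toCoverData.OfTypeLTorsTheta (H2' ⊓ X.PiX) := by
  obtain ⟨c, hc⟩ := h
  exact ⟨c, by rw [X.map_conj_inf_PiX]; exact X.isTypeLTorsTheta_inf_PiX hc⟩

/-- **Def 2.3 ⇒ Def 2.1, up to isomorphism**: if `H₂'` is of type `(1, l-torsΘ)±` then `(H₂' ∩ Π_X)·Δ̄_Θ` is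
of type `(1, l-tors)` (by `isTypeLTors_inf_PiX_sup_barTheta` on the conjugate).
[cite: MochizukiEtTh2009, Def 2.1 p.36] -/
theorem ofTypeLTors_inf_PiX_sup_barTheta {H2' : Subgroup X.PiC}
    (h : X.toCoverData.OfTypeLTorsThetaPm H2') :
    X.toCoverData.OfTypeLTors ((H2' ⊓ X.PiX) ⊔ X.barTheta) := by
  obtain ⟨c, hc⟩ := h
  exact ⟨c, by
    rw [X.map_conj_sup_barTheta, X.map_conj_inf_PiX]
    exact X.isTypeLTors_inf_PiX_sup_barTheta hc⟩

end CoverDataAx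

/-! ## §B. The named instance: the tower of the Def 2.5 interface `TemperedCoverData` -/

namespace TemperedCoverData

variable {l : ℕ} (T : TemperedCoverData.{u} l)

/-- **`Π_C̲ = T.PiCu` IS of type `(1, l-tors)±`** (Def 2.1), for every `T : TemperedCoverData l`: it is the
`Π_C̲ = H'` over which the chosen `Π_C̲̲` was built (abc-iut-L2-d3 `PiCu_eq`).
[cite: MochizukiEtTh2009, Def 2.1 p.36] -/
theorem isTypeLTorsPm_PiCu : T.toCoverData.IsTypeLTorsPm T.PiCu := by
  unfold PiCu
  exact T.toCoverDataAx.isTypeLTorsPm_sup_barTheta T.isTypeLTorsThetaPm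

/-- **`Π_X̲̲ = T.PiXuu` IS of type `(1, l-torsΘ)`** (Def 2.3), for every `T : TemperedCoverData l`: it is the
`Π_X̲̲ = S·E` of the construction of the chosen `Π_C̲̲` (abc-iut-L2-d3 `PiXuu_eq_sup`).
[cite: MochizukiEtTh2009, Def 2.3 p.38] -/
theorem isTypeLTorsTheta_PiXuu : T.toCoverData.IsTypeLTorsTheta T.PiXuu := by
  unfold PiXuu
  exact T.toCoverDataAx.isTypeLTorsTheta_inf_PiX T.isTypeLTorsThetaPm

/-- **`Π_X̲ = T.PiXu` IS of type `(1, l-tors)`** (Def 2.1), for every `T : TemperedCoverData l`: it is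
`Π_X̲ = H' ∩ Π_X` for the `Π_C̲ = H'` of the construction (abc-iut-L2-d3 `PiXu_eq_inf`).
[cite: MochizukiEtTh2009, Def 2.1 p.36] -/
theorem isTypeLTors_PiXu : T.toCoverData.IsTypeLTors T.PiXu := by
  unfold PiXu PiXuu
  exact T.toCoverDataAx.isTypeLTors_inf_PiX_sup_barTheta T.isTypeLTorsThetaPm

/-- **Cartesian square `X̲ → X` over `C̲ → C` at the interface: `Π_X̲ = Π_C̲ ∩ Π_X`** (`T.PiXu = T.PiCu ⊓ Π_X`;
the companion `Π_X̲̲ = Π_C̲̲ ∩ Π_X` is the definition of `T.PiXuu`). [cite: MochizukiEtTh2009, Def 2.1 p.36] -/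
theorem PiXu_eq_PiCu_inf_PiX : T.PiXu = T.PiCu ⊓ T.PiX := by
  unfold PiXu PiXuu PiCu
  exact (T.toCoverDataAx.sup_barTheta_inf_PiX_eq T.isTypeLTorsThetaPm).symm

/-- **INSTANCE FORM of FACT-LIST row F-0592 (`OfTypeLTors`, [EtTh] Def 2.1 "of type `(1, l-tors)`") at the
named instance**: for every `T : TemperedCoverData l`, the interface's `Π_X̲ = T.PiXu` is of type
`(1, l-tors)` (it IS an `X̲` of the construction: `isTypeLTors_PiXu`, conjugate by `1`).  The universal
closure ("every subgroup of `Π_C` is of type `(1, l-tors)`") is false: abc-iut-w6-d032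
`HeisenbergWitness.not_forall_ofTypeLTors`. [cite: MochizukiEtTh2009, Def 2.1 p.36] -/
theorem ofTypeLTors_holds :
    Literature.AnabelianGeometry.EtaleTheta.ThetaCovers.CoverData.OfTypeLTors T.toCoverData T.PiXu :=
  T.isTypeLTors_PiXu.ofTypeLTors

/-- **INSTANCE FORM of FACT-LIST row F-0593 (`OfTypeLTorsPm`, [EtTh] Def 2.1 "of type `(1, l-tors)±`") at
the named instance**: for every `T : TemperedCoverData l`, the interface's `Π_C̲ = T.PiCu` is of type
`(1, l-tors)±` (`isTypeLTorsPm_PiCu`, conjugate by `1`).  Universal closure false: abc-iut-w6-d032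
`HeisenbergWitness.not_forall_ofTypeLTorsPm`. [cite: MochizukiEtTh2009, Def 2.1 p.36] -/
theorem ofTypeLTorsPm_holds :
    Literature.AnabelianGeometry.EtaleTheta.ThetaCovers.CoverData.OfTypeLTorsPm T.toCoverData T.PiCu :=
  T.isTypeLTorsPm_PiCu.ofTypeLTorsPm

/-- **INSTANCE FORM of FACT-LIST row F-0594 (`OfTypeLTorsTheta`, [EtTh] Def 2.3 "of type `(1, l-torsΘ)`") at
the named instance**: for every `T : TemperedCoverData l`, the interface's `Π_X̲̲ = T.PiXuu = Π_C̲̲ ∩ Π_X` is of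
type `(1, l-torsΘ)` (`isTypeLTorsTheta_PiXuu`, conjugate by `1`).  Universal closure false: abc-iut-w6-d032
`HeisenbergWitness.not_forall_ofTypeLTorsTheta`. [cite: MochizukiEtTh2009, Def 2.3 p.38] -/
theorem ofTypeLTorsTheta_holds :
    Literature.AnabelianGeometry.EtaleTheta.ThetaCovers.CoverData.OfTypeLTorsTheta T.toCoverData T.PiXuu :=
  T.isTypeLTorsTheta_PiXuu.ofTypeLTorsTheta

/-- **INSTANCE FORM of FACT-LIST row F-0595 (`OfTypeLTorsThetaPm`, [EtTh] Def 2.3 "of type `(1, l-torsΘ)±`")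
at the named instance**: for every `T : TemperedCoverData l`, the interface's chosen `Π_C̲̲ = T.PiCuu` is of type
`(1, l-torsΘ)±` (field `isTypeLTorsThetaPm`, conjugate by `1`).  Universal closure false: abc-iut-w6-d032
`HeisenbergWitness.not_forall_ofTypeLTorsThetaPm`. [cite: MochizukiEtTh2009, Def 2.3 p.38] -/
theorem ofTypeLTorsThetaPm_holds :
    Literature.AnabelianGeometry.EtaleTheta.ThetaCovers.CoverData.OfTypeLTorsThetaPm T.toCoverData
      T.PiCuu :=
  T.isTypeLTorsThetaPm.ofTypeLTorsThetaPm

end TemperedCoverData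

end ThetaCovers

end Literature.AnabelianGeometry.EtaleTheta
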